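import Mathlib
import HarnessLib
import Literature.Analysis.FluidPDE.SuitableWeak
import Literature.Analysis.FluidPDE.SelfSimilar
import Literature.Analysis.FluidPDE.LocalTypeI
import Literature.Analysis.FluidPDE.SpaceTimeRescaling
import Literature.Analysis.FluidPDE.LocalTypeIScaling
import Literature.Analysis.FluidPDE.LocalTypeICongr
import Literature.Analysis.FluidPDE.LocalTypeIReverseZoom
import Literature.Analysis.FluidPDE.SlabTypeICompactness
import Literature.Analysis.FluidPDE.TypeIRateOseenMildRepresentative
import Summits.NavierStokesRegularity.NavierStokesRegularity.Theorems.RellichScarApexLocalisationSpherePersistence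
import Summits.NavierStokesRegularity.NavierStokesRegularity.Theorems.RecurrentProfilesRecurrentReductionOrbit

/-!
# Local apex at a singular point gives an apex singular profile
# (line russian-doll-multiplicity of crux `RellichScar.ApexLocalisation`, stub `stub_rdLocalApex`)

Let `(w, q, H)` be a suitable weak solution of Navier–Stokes on the backward slab
`𝕊 = (-∞, 0) × ℝ³` with weak spatial gradient `H` and Albritton–Barker quantity `𝐈 ≤ I < ⊤`,
which is backward-singular at the space–time origin and obeys the LOCAL apex bound
`‖w(t, x)‖ ≤ K / (‖x‖ + √(−t))` on the parabolic cylinder `Q_r(0, 0)`, `r > 0`.  Then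
(`stub_rdLocalApex`) an apex-class singular profile exists: a suitable weak slab solution
`(u, p, G)` with `𝐈 < ⊤`, the GLOBAL apex bound `HasTypeIDecay C' u` and a backward-singular
origin.

Proof (zoom in at the origin; Albritton–Barker 2019, Lemma 2.2 + Prop. 2.3 on the slab, i.e. the
tree's ENGINE `slab_typeI_compactness`):

0. `0 ≤ K` (the bound at `(t, x) = (-(r/2)², 0) ∈ Q_r(0,0)`);
1. the Navier–Stokes zooms `w_k(t, x) = λ_k w(λ_k² t, λ_k x)`, `λ_k = 1/(k+1)`, are suitable weak
   slab solutions with the SAME `𝐈 ≤ I` (`zoom_slabProfile`), are singular at the origin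
   (`isBackwardSingularPoint_zoom`), and obey the apex bound on `Q_{r/λ_k}(0, 0)` (the bound is
   invariant under the Navier–Stokes scaling about the origin);
2. the ENGINE extracts a subsequence converging in `L³(Q(0, R))`, every `R > 0`, to a suitable
   weak slab solution `(u₀, p₀, H₀)` with `𝐈 ≤ 4 I`; as every zoom has `‖w_k‖_{L^∞(Q(0,R))} = ∞`,
   the persistence clause makes the origin a backward singular point of `u₀`;
3. the apex bound passes to `u₀` a.e. on the slab (a.e.-convergent subsequences on the exhausting
   balls `Q(0, n+1)`, on each of which the zooms obey the bound for `k` large since `λ_k → 0`);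
4. `exists_apex_profile_repr` gives a representative in the pointwise apex class `HasTypeIDecay K`
   with the same pressure, gradient, `𝐈 < ⊤` and singular origin.

## References

* D. Albritton, T. Barker, *On local Type I singularities of the Navier–Stokes equations and
  Liouville theorems*, J. Math. Fluid Mech. 21 (2019) = arXiv:1811.00502, Lemma 2.2, Prop. 2.3,
  §3. [AlbrittonBarker2019]
* G. Koch, N. Nadirashvili, G. Seregin, V. Šverák, Acta Math. 203 (2009), (1.6). [KNSS2009]
-/

noncomputable section

set_option linter.dupNamespace false

namespace Summit.NavierStokesRegularity.NavierStokesRegularity.Theorems.RellichScarApexLocalisation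

open MeasureTheory Set Function Metric Filter Topology TopologicalSpace
open scoped ENNReal NNReal
open Literature.Analysis Literature.Analysis.FluidPDE

local notation "E³" => EuclideanSpace ℝ (Fin 3)

/-- The open backward slab `(-∞, 0) × ℝ³` (time first). -/
local notation "𝕊" => Literature.Analysis.FluidPDE.slab (EuclideanSpace ℝ (Fin 3)) (Set.Iio (0 : ℝ)) isOpen_Iio

/-! ### Tools -/

/-- **The local apex bound is invariant under the Navier–Stokes zoom about the origin.**
If `‖w(t, x)‖ ≤ K/(‖x‖ + √(−t))` on `Q_r(0,0)` and `0 < c`, `c R ≤ r`, then the zoom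
`w_c(t, x) = c w(c² t, c x)` obeys `‖w_c(t, x)‖ ≤ K/(‖x‖ + √(−t))` on `Q_R(0,0)`
(`c ‖w(c²t, cx)‖ ≤ c K/(c‖x‖ + c√(−t))`). -/
theorem rdLocalApex_zoom_bound {w : ℝ → E³ → E³} {K r c R : ℝ} (hc : 0 < c) (hcR : c * R ≤ r)
    (hb : ∀ (t : ℝ) (x : E³), -r ^ 2 < t → t < 0 → ‖x‖ < r →
      ‖w t x‖ ≤ K / (‖x‖ + Real.sqrt (-t)))
    {z : ℝ × E³} (hz : z ∈ parabolicCylinder R (0 : ℝ × E³)) :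
    ‖(c • stPull (c ^ 2) c (0 : ℝ) (0 : E³) w) z.1 z.2‖ ≤ K / (‖z.2‖ + Real.sqrt (-z.1)) := by
  rw [mem_parabolicCylinder] at hz
  simp only [Prod.fst_zero, Prod.snd_zero, zero_sub, dist_zero_right] at hz
  obtain ⟨⟨hz1, hz0⟩, hzR⟩ := hz
  have hR0 : 0 ≤ R := (norm_nonneg _).trans hzR.le
  have hcR0 : 0 ≤ c * R := mul_nonneg hc.le hR0
  have h1 : -r ^ 2 < c ^ 2 * z.1 := by
    have hsq : (c * R) ^ 2 ≤ r ^ 2 := pow_le_pow_left₀ hcR0 hcR 2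
    nlinarith [mul_lt_mul_of_pos_left hz1 (pow_pos hc 2)]
  have h2 : c ^ 2 * z.1 < 0 := mul_neg_of_pos_of_neg (pow_pos hc 2) hz0
  have h3 : ‖c • z.2‖ < r := by
    rw [norm_smul, Real.norm_of_nonneg hc.le]
    exact lt_of_lt_of_le (mul_lt_mul_of_pos_left hzR hc) hcR
  have h := hb (c ^ 2 * z.1) (c • z.2) h1 h2 h3
  have hsq : Real.sqrt (-(c ^ 2 * z.1)) = c * Real.sqrt (-z.1) := by
    rw [show -(c ^ 2 * z.1) = c ^ 2 * (-z.1) by ring, Real.sqrt_mul (sq_nonneg c),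
      Real.sqrt_sq hc.le]
  rw [norm_smul, Real.norm_of_nonneg hc.le, hsq, ← mul_add] at h
  have hpos : 0 < ‖z.2‖ + Real.sqrt (-z.1) :=
    add_pos_of_nonneg_of_pos (norm_nonneg _) (Real.sqrt_pos.2 (by linarith))
  rw [smul_stPull_apply, zero_add, zero_add, norm_smul, Real.norm_of_nonneg hc.le]
  calc c * ‖w (c ^ 2 * z.1) (c • z.2)‖ ≤ c * (K / (c * (‖z.2‖ + Real.sqrt (-z.1)))) :=
        mul_le_mul_of_nonneg_left h hc.le
    _ = K / (‖z.2‖ + Real.sqrt (-z.1)) := by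
        field_simp

/-- **A local space–time bound, eventually valid on each exhausting ball, passes to `L³_loc` limits
almost everywhere on the slab.**  If measurable fields `W j` converge in `L³(Q(0, n+1))` for every
`n` to a measurable `v`, and for every `n` the bound `‖W j (t,x)‖ ≤ K/(‖x‖ + √(−t))` holds on
`Q(0, n+1)` for all `j` large, then `‖v(t, x)‖ ≤ K/(‖x‖ + √(−t))` for a.e. `(t, x)` in
`(-∞, 0) × ℝ³` (a.e.-convergent subsequences ball by ball). -/
theorem rdLocalApex_ae_apex_of_tendsto_eLpNorm {W : ℕ → ℝ → E³ → E³} {v : ℝ → E³ → E³} {K : ℝ}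
    (hWm : ∀ j, AEStronglyMeasurable (uncurry (W j))
      (volume.restrict (Iio (0 : ℝ) ×ˢ (univ : Set E³))))
    (hvm : AEStronglyMeasurable (uncurry v) (volume.restrict (Iio (0 : ℝ) ×ˢ (univ : Set E³))))
    (hWK : ∀ n : ℕ, ∀ᶠ j in atTop, ∀ z ∈ parabolicCylinder ((n : ℝ) + 1) (0 : ℝ × E³),
      ‖W j z.1 z.2‖ ≤ K / (‖z.2‖ + Real.sqrt (-z.1)))
    (hL3 : ∀ n : ℕ, Tendsto (fun j => eLpNorm (uncurry (W j) - uncurry v) 3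
      (volume.restrict (parabolicCylinder ((n : ℝ) + 1) (0 : ℝ × E³)))) atTop (𝓝 0)) :
    ∀ᵐ z ∂(volume.restrict (Iio (0 : ℝ) ×ˢ (univ : Set E³))),
      ‖v z.1 z.2‖ ≤ K / (‖z.2‖ + Real.sqrt (-z.1)) := by
  refine ae_restrict_of_ae_restrict_of_subset
    RellichScarApexLocalisation.lowerHalf_subset_iUnion_parabolicCylinder ?_
  rw [ae_restrict_iUnion_iff]
  intro n
  set Q₀ : Set (ℝ × E³) := parabolicCylinder ((n : ℝ) + 1) (0 : ℝ × E³) with hQ₀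
  have hQ₀s : Q₀ ⊆ Iio (0 : ℝ) ×ˢ (univ : Set E³) := parabolicCylinder_origin_subset_slab _
  have hWm' : ∀ j, AEStronglyMeasurable (uncurry (W j)) (volume.restrict Q₀) := fun j =>
    (hWm j).mono_measure (Measure.restrict_mono hQ₀s le_rfl)
  have hvm' : AEStronglyMeasurable (uncurry v) (volume.restrict Q₀) :=
    hvm.mono_measure (Measure.restrict_mono hQ₀s le_rfl)
  have hTIM : TendstoInMeasure (volume.restrict Q₀) (fun j => uncurry (W j)) atTop (uncurry v) :=
    tendstoInMeasure_of_tendsto_eLpNorm (by norm_num) hWm' hvm' (hL3 n)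
  obtain ⟨ns, hns, hae⟩ := hTIM.exists_seq_tendsto_ae
  have hev : ∀ᶠ i in atTop, ∀ z ∈ Q₀, ‖W (ns i) z.1 z.2‖ ≤ K / (‖z.2‖ + Real.sqrt (-z.1)) :=
    hns.tendsto_atTop.eventually (hWK n)
  filter_upwards [hae, ae_restrict_mem (isOpen_parabolicCylinder _ _).measurableSet] with z hz hzQ
  refine le_of_tendsto hz.norm ?_
  filter_upwards [hev] with i hi
  exact hi z hzQ

/-! ### The stub -/

/-- **S3 (stub_rdLocalApex).** If a suitable weak slab solution with `𝐈 ≤ I < ⊤`, backward-singular at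
the origin, obeys the space–time bound `‖w(t,x)‖ ≤ K/(‖x‖ + √(−t))` on the cylinder `Q_r(0,0)`, then an
apex-class singular profile exists: the zooms `λ w(λ² t, λ x)`, `λ ↓ 0`, are singular at the origin and
obey the bound on `Q_{r/λ}(0,0)`; the ENGINE gives an origin-singular limit with `𝐈 ≤ 4 I` obeying it
a.e. on the slab, and `exists_apex_profile_repr` a representative in the pointwise apex class.
[cite: AlbrittonBarker2019, Lemma 2.2, Prop. 2.3 and §3] -/
theorem stub_rdLocalApex :
    ∀ (K r : ℝ) (I : ℝ≥0∞), I < ⊤ → 0 < r →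
      ∀ (w : ℝ → E³ → E³) (q : ℝ → E³ → ℝ) (H : ℝ → E³ → E³ →L[ℝ] E³),
        IsSuitableWeakSolutionOn 𝕊 1 0 w q → HasWeakSpatialGradientOn 𝕊 w H →
        typeIBound (Iio (0 : ℝ) ×ˢ univ) w q H ≤ I → IsBackwardSingularPoint w 0 →
        (∀ (t : ℝ) (x : E³), -r ^ 2 < t → t < 0 → ‖x‖ < r → ‖w t x‖ ≤ K / (‖x‖ + Real.sqrt (-t))) →
        ∃ (C' : ℝ) (u : ℝ → E³ → E³) (p : ℝ → E³ → ℝ) (G : ℝ → E³ → E³ →L[ℝ] E³),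
          IsSuitableWeakSolutionOn 𝕊 1 0 u p ∧ HasWeakSpatialGradientOn 𝕊 u G ∧
          typeIBound (Iio (0 : ℝ) ×ˢ univ) u p G < ⊤ ∧ HasTypeIDecay C' u ∧
          IsBackwardSingularPoint u 0 := by
  intro K r I hI hr w q H hsw hwg hIle hsing hbound
  -- ## Step 0: `0 ≤ K` (the bound at `(t, x) = (-(r/2)², 0)`)
  have hK0 : 0 ≤ K := by
    have ht1 : -r ^ 2 < -(r / 2) ^ 2 := by nlinarith
    have ht0 : -(r / 2) ^ 2 < 0 := by
      have : 0 < (r / 2) ^ 2 := by positivity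
      linarith
    have h := hbound (-(r / 2) ^ 2) 0 ht1 ht0 (by simpa using hr)
    rw [norm_zero, zero_add, neg_neg, Real.sqrt_sq (by positivity)] at h
    have h' : 0 ≤ K / (r / 2) := (norm_nonneg _).trans h
    by_contra hK
    push Not at hK
    have : K / (r / 2) < 0 := div_neg_of_neg_of_pos hK (by positivity)
    linarith
  -- ## Step 1: the zooms `λ_k w(λ_k² t, λ_k x)`, `λ_k = 1/(k+1)`, and their class data
  set lam : ℕ → ℝ := fun k => 1 / ((k : ℝ) + 1) with hlam
  have hlam0 : ∀ k, 0 < lam k := fun k => by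
    simp only [hlam]
    positivity
  have hlamto : Tendsto lam atTop (𝓝 0) := tendsto_one_div_add_atTop_nhds_zero_nat
  set wk : ℕ → ℝ → E³ → E³ := fun k => lam k • stPull (lam k ^ 2) (lam k) (0 : ℝ) (0 : E³) w
    with hwk
  set qk : ℕ → ℝ → E³ → ℝ := fun k => lam k ^ 2 • stPull (lam k ^ 2) (lam k) (0 : ℝ) (0 : E³) q
    with hqk
  set Hk : ℕ → ℝ → E³ → E³ →L[ℝ] E³ :=
    fun k => lam k ^ 2 • stPull (lam k ^ 2) (lam k) (0 : ℝ) (0 : E³) H with hHk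
  have hswk : ∀ k, IsSuitableWeakSolutionOn 𝕊 1 0 (wk k) (qk k) := fun k =>
    (zoom_slabProfile hsw hwg (hlam0 k)).1
  have hwgk : ∀ k, HasWeakSpatialGradientOn 𝕊 (wk k) (Hk k) := fun k =>
    (zoom_slabProfile hsw hwg (hlam0 k)).2.1
  have hIk : ∀ k, typeIBound (Iio (0 : ℝ) ×ˢ univ) (wk k) (qk k) (Hk k) ≤ I := fun k =>
    (zoom_slabProfile hsw hwg (hlam0 k)).2.2.le.trans hIle
  have hsingk : ∀ k, IsBackwardSingularPoint (wk k) 0 := fun k =>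
    isBackwardSingularPoint_zoom hsing (hlam0 k)
  -- ## Step 2: the ENGINE; persistence at the fixed origin
  obtain ⟨u₀, p₀, H₀, σ, hσ, hsw₀, hwg₀, hI₀, hconv₀, hpers₀⟩ :=
    slab_typeI_compactness I wk qk Hk hI hswk hwgk hIk
  have hsing₀ : IsBackwardSingularPoint u₀ 0 := by
    refine hpers₀ fun R hR => ?_
    have hconst : (fun j => eLpNorm (uncurry (wk (σ j))) ⊤
        (volume.restrict (parabolicCylinder R (0 : ℝ × E³)))) = fun _ => (⊤ : ℝ≥0∞) :=
      funext fun j => hsingk (σ j) R hR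
    rw [hconst]
    exact limsup_const ⊤
  -- ## Step 3: the apex bound a.e. for the limit
  have hapex : ∀ᵐ z ∂(volume.restrict (Iio (0 : ℝ) ×ˢ (univ : Set E³))),
      ‖u₀ z.1 z.2‖ ≤ K / (‖z.2‖ + Real.sqrt (-z.1)) := by
    refine rdLocalApex_ae_apex_of_tendsto_eLpNorm (W := fun j => wk (σ j))
      (fun j => (hwgk (σ j)).locallyIntegrableOn.aestronglyMeasurable)
      hwg₀.locallyIntegrableOn.aestronglyMeasurable (fun n => ?_)
      (fun n => hconv₀ ((n : ℝ) + 1) (by positivity))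
    have hn : (0 : ℝ) < (n : ℝ) + 1 := by positivity
    have hlt : (0 : ℝ) < r / ((n : ℝ) + 1) := by positivity
    filter_upwards [(hlamto.comp hσ.tendsto_atTop).eventually_lt_const hlt] with j hj z hz
    have hcR : lam (σ j) * ((n : ℝ) + 1) ≤ r := by
      have hj' : lam (σ j) < r / ((n : ℝ) + 1) := hj
      rw [lt_div_iff₀ hn] at hj'
      exact hj'.le
    exact rdLocalApex_zoom_bound (hlam0 (σ j)) hcR hbound hz
  -- ## Step 4: the representative in the pointwise apex class
  have hI₀top : typeIBound (Iio (0 : ℝ) ×ˢ univ) u₀ p₀ H₀ < ⊤ :=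
    lt_of_le_of_lt hI₀ (ENNReal.mul_lt_top (by simp) hI)
  obtain ⟨u', -, hsw', hwg', hI', hdec', hsing'⟩ :=
    exists_apex_profile_repr hK0 hsw₀ hwg₀ hI₀top hsing₀ hapex
  exact ⟨K, u', p₀, H₀, hsw', hwg', hI', hdec', hsing'⟩

end Summit.NavierStokesRegularity.NavierStokesRegularity.Theorems.RellichScarApexLocalisation

end
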